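import Summits.BirchSwinnertonDyer.Rank1Residual.WAll.TargetCMTwoRamifiedThetaFour
import Summits.BirchSwinnertonDyer.BirchSwinnertonDyer.Theorems.PrintCf2RamifiedOffTYZBookedIsogeny
import Summits.BirchSwinnertonDyer.Rank1Residual.P2.CongruentNumberThetaFourPrimesDescent
import HarnessLib

/-!
# Route `PrintCf2`, crux stmt-BirchSwinnertonDyer-20509 `RamifiedOffTYZOfFacts` — THE FOUR-PRIME THETA FAMILY
# (`n = 2p₁p₂p₃p₄`, type `(3,5,5,5)`, `g(n)` odd) CARVED OUT OF THE ISOGENY-CLASS RESIDUAL AND CLOSED BY NAME beyond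
# the bundle, from EXACTLY the antecedent of aside 21185; the residual stub re-cut (cell `bsd-print-cf2`, seat p1 = lead)

HONEST FRAMING (cell `bsd-print-cf2`; route `PrintCf2`; crux 20509 = `𝔅_ram → WAllCornerFTwoRamifiedOffTYZProved`, the
residual of the ramified type OFF the proved TYZ families, OPEN): after the isogeny saturation
(`Theorems/PrintCf2RamifiedOffTYZBookedIsogeny.lean`, this seat) the registered residual is
`𝔅_ram → WAllCornerFTwoRamifiedOffBookedIsogeny`; the W-ALL file `WAll/TargetCMTwoRamifiedThetaFour.lean` (this seat) names
the four-prime theta-descent family of cell `bsd-monsky` (prover-B) inside it, its leaf `WAllCornerFTwoRamifiedThetaFour`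
(isogeny classes) and the residual off it. This file proves:

* §1 CLOSER BY NAME `wAllCornerFTwoRamifiedThetaFour_of_facts (hCM) (h11) (hGZK) (hCAS) (hMOD)` — prover-B's family
  theorem `P2.ThetaDescent.rankOne_sha_bsdp_two_two_mul_3555_family_descent` (`ord_{s=1} L = 1 ∧ rank 1 ∧ Ш[2^∞] = 0 ∧
  BSD(E_n, 2)` on the whole family, relative to {`tyz_cmPointGaloisData`, `thm11_parity_of_scriptL`, GZK} ONLY — the
  `2`-Selmer bound being a tree theorem, `s(n) = 1` kernel-decided on the type) moved to every globally minimal `ℚ`-model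
  fact-free (`CornerFTwo.CongruentNumber.analyticRank_eq_one_and_bsdp_two_of_smul`) and along `ℚ`-isogenies by Cassels
  transport (`PrintCf2.bsdp_two_of_isIsogenous_of_facts`, conjuncts 1–3 of `𝔅_ram`); and the Plus-shaped term
  `thetaFour_of_bundlePlus : (𝔅_ram ∧ thm11_parity_of_scriptL ∧ tyz_cmPointGaloisData) → WAllCornerFTwoRamifiedThetaFour` —
  EXACTLY the antecedent of the CLOSED aside 21185 `RamifiedThetaOfFactsPlus` (no new fact aside needed).
* §2 the lead's bookkeeping: the v4 residual stub `𝔅_ram → WAllCornerFTwoRamifiedOffBookedIsogeny` follows from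
  «𝔅_ram ⟹ four-prime leaf» (closable beyond the bundle, §1) and «𝔅_ram ⟹ WAllCornerFTwoRamifiedOffBookedIsogenyOffThetaFour»
  (OPEN, no print); and the composition `offTYZProved_of_bundle_of_uPlus_of_theta_of_shuZhai_of_thetaFour_of_off`.

TURNKEY for -plan (aside, leaf form, same antecedent as 21185): `RamifiedThetaFourOfFactsPlus :=
(<𝔅_ram VERBATIM> ∧ Literature.NumberTheory.EllipticCurves.TianYuanZhang2017.thm11_parity_of_scriptL ∧
Literature.NumberTheory.EllipticCurves.TianYuanZhang2017.tyz_cmPointGaloisData) →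
Summit.BirchSwinnertonDyer.WAllCornerFTwoRamifiedThetaFour`, closed by `fun h ↦ Summit.BirchSwinnertonDyer.PrintCf2.thetaFour_of_bundlePlus h`.
Booking currency LITERAL-by-name(hCM) (as 21185). beyond-print theorem: YES (no printed statement covers `k = 4`; Monsky
1990 p. 67 Rem. (3) conjectures `k = 2` only; TYZ Thm 1.2 is silent on part of the family, e.g. `n = 11310`).
No route file imported. Nothing asserted.
[cite: TianYuanZhang2017, Thm. 1.1, §1 (1.1), Thm. 3.5, Thm. 3.6] [cite: HeathBrown1994SelmerCongruentII, Appendix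
(Monsky), typescript p. 41 L20–L36] [cite: Monsky1990MockHeegner, p. 67 Remark (3)] [cite: Miller2011LMS, Def. 1.1
(arXiv:1010.2431 p. 3)] [cite: MilneADT2006, Thm. I.7.3]
-/

noncomputable section

open scoped Classical

open WeierstrassCurve Summit.BirchSwinnertonDyer Summit.BirchSwinnertonDyer.Rank1Residual
  Literature.NumberTheory.EllipticCurves Literature.NumberTheory.EllipticCurves.Rank1Residual
  Literature.NumberTheory.EllipticCurves.TianYuanZhang2017

set_option autoImplicit false

namespace Summit.BirchSwinnertonDyer.PrintCf2

/-! ## §1 CLOSER BY NAME of the leaf `WAllCornerFTwoRamifiedThetaFour` (beyond the bundle) -/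

/-- **CLOSER of the four-prime theta leaf**, modulo the TYZ §3 CM-point display (`hCM`), TYZ Thm 1.1 as printed (`h11`),
GZK (`hGZK`), Cassels (`hCAS`) and modularity (`hMOD`). A member `W₀` is a model of `E_n` in the family (prover-B's
`rankOne_sha_bsdp_two_two_mul_3555_family_descent`, moved to the model fact-free); `W ∼ W₀` by Cassels transport in analytic
rank one. The leaf's hypotheses `HasCM`, `CMRamified` are not used (they HOLD,
`hasCM_and_cmRamified_two_of_congruentThetaFourIsogenyClass`). [cite: TianYuanZhang2017, Thm. 1.1, Thm. 3.5, Thm. 3.6]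
[cite: HeathBrown1994SelmerCongruentII, Appendix (Monsky), typescript p. 41 L20–L36] [cite: MilneADT2006, Thm. I.7.3] -/
theorem wAllCornerFTwoRamifiedThetaFour_of_facts (hCM : tyz_cmPointGaloisData) (h11 : thm11_parity_of_scriptL)
    (hGZK : rank_eq_analyticRank_of_analyticRank_le_one) (hCAS : bsdRHS_eq_of_isIsogenous)
    (hMOD : hasEntireLFunction_rat) : WAllCornerFTwoRamifiedThetaFour := by
  intro W _ _ _ hr _ hI
  obtain ⟨W₀, _, _, hiso, hmem⟩ := hI
  obtain ⟨p₁, p₂, p₃, p₄, hp₁, hp₂, hp₃, hp₄, h₁, h₂, h₃, h₄, h23, h24, h34, hbits, C, hC⟩ := hmem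
  have h := P2.ThetaDescent.rankOne_sha_bsdp_two_two_mul_3555_family_descent hCM h11 hGZK p₁ p₂ p₃ p₄ hp₁ hp₂ hp₃ hp₄
    h₁ h₂ h₃ h₄ h23 h24 h34 hbits
  have h₀ : BSDp W₀ 2 :=
    (P2.CornerFTwo.CongruentNumber.analyticRank_eq_one_and_bsdp_two_of_smul
      (squarefree_of_thetaFour hp₁ hp₂ hp₃ hp₄ h₁ h₂ h₃ h₄ h23 h24 h34) ⟨h.1, h.2.2.2⟩ hC).2
  exact bsdp_two_of_isIsogenous_of_facts hCAS hGZK hMOD hiso hr h₀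

/-- **The four-prime theta leaf from the bundle PLUS the two displayed facts** — the term of the `…OfFactsPlus` aside the
planner files (antecedent `𝔅_ram ∧ thm11_parity_of_scriptL ∧ tyz_cmPointGaloisData`, VERBATIM that of aside 21185; uses
conjuncts 1–3 of `𝔅_ram` and the two extras). [cite: TianYuanZhang2017, Thm. 1.1, Thm. 3.5, Thm. 3.6] [cite: Miller2011LMS, Def. 1.1] -/
theorem thetaFour_of_bundlePlus
    (h : (Literature.NumberTheory.EllipticCurves.rank_eq_analyticRank_of_analyticRank_le_one ∧ WeierstrassCurve.hasEntireLFunction_rat ∧ WeierstrassCurve.bsdRHS_eq_of_isIsogenous ∧ Literature.NumberTheory.EllipticCurves.bsdTriple_of_hasCM_of_L_one_ne_zero ∧ Literature.NumberTheory.EllipticCurves.TianYuanZhang2017.thm12_parity_of_scriptL' ∧ Literature.NumberTheory.EllipticCurves.Tian2014.thm13_rank_one_and_sha_odd ∧ Literature.NumberTheory.QuadraticFields.RedeiReichardt.redeiReichardt_fourTwoCard_classGroup ∧ Literature.NumberTheory.EllipticCurves.LiLiuTian2024.thm12_bsd_congruentNumberCurve ∧ Literature.NumberTheory.EllipticCurves.Monsky1990.cor515_rank_eq_one_and_card_selmerGroup_two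 ∧ Literature.NumberTheory.EllipticCurves.HeathBrown1994.monsky_card_selmerGroup_two_even ∧ Literature.NumberTheory.EllipticCurves.Tian2014.tian2014_system_sMinus_genus) ∧ Literature.NumberTheory.EllipticCurves.TianYuanZhang2017.thm11_parity_of_scriptL ∧
      Literature.NumberTheory.EllipticCurves.TianYuanZhang2017.tyz_cmPointGaloisData) :
    Summit.BirchSwinnertonDyer.WAllCornerFTwoRamifiedThetaFour :=
  wAllCornerFTwoRamifiedThetaFour_of_facts h.2.2 h.2.1 h.1.1 h.1.2.2.1 h.1.2.1

/-! ## §2 Skeleton bookkeeping of crux 20509: the v4 residual stub re-cut, and the composition -/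

/-- **The v4 residual stub `stub_offTYZ_residual` (𝔅_ram ⟹ `WAllCornerFTwoRamifiedOffBookedIsogeny`) is CUT**: it follows
from «𝔅_ram ⟹ four-prime theta leaf» (closable beyond the bundle, `thetaFour_of_bundlePlus`) and «𝔅_ram ⟹ the residual
off the four-prime family» (OPEN, no print). [folklore] -/
theorem stub_offTYZ_residual_of_thetaFour_of_off
    (hT : (Literature.NumberTheory.EllipticCurves.rank_eq_analyticRank_of_analyticRank_le_one ∧ WeierstrassCurve.hasEntireLFunction_rat ∧ WeierstrassCurve.bsdRHS_eq_of_isIsogenous ∧ Literature.NumberTheory.EllipticCurves.bsdTriple_of_hasCM_of_L_one_ne_zero ∧ Literature.NumberTheory.EllipticCurves.TianYuanZhang2017.thm12_parity_of_scriptL' ∧ Literature.NumberTheory.EllipticCurves.Tian2014.thm13_rank_one_and_sha_odd ∧ Literature.NumberTheory.QuadraticFields.RedeiReichardt.redeiReichardt_fourTwoCard_classGroup ∧ Literature.NumberTheory.EllipticCurves.LiLiuTian2024.thm12_bsd_congruentNumberCurve ∧ Literature.NumberTheory.EllipticCurves.Monsky1990.cor515_rank_eq_one_and_card_selmerGroup_two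 ∧ Literature.NumberTheory.EllipticCurves.HeathBrown1994.monsky_card_selmerGroup_two_even ∧ Literature.NumberTheory.EllipticCurves.Tian2014.tian2014_system_sMinus_genus) → Summit.BirchSwinnertonDyer.WAllCornerFTwoRamifiedThetaFour)
    (hO : (Literature.NumberTheory.EllipticCurves.rank_eq_analyticRank_of_analyticRank_le_one ∧ WeierstrassCurve.hasEntireLFunction_rat ∧ WeierstrassCurve.bsdRHS_eq_of_isIsogenous ∧ Literature.NumberTheory.EllipticCurves.bsdTriple_of_hasCM_of_L_one_ne_zero ∧ Literature.NumberTheory.EllipticCurves.TianYuanZhang2017.thm12_parity_of_scriptL' ∧ Literature.NumberTheory.EllipticCurves.Tian2014.thm13_rank_one_and_sha_odd ∧ Literature.NumberTheory.QuadraticFields.RedeiReichardt.redeiReichardt_fourTwoCard_classGroup ∧ Literature.NumberTheory.EllipticCurves.LiLiuTian2024.thm12_bsd_congruentNumberCurve ∧ Literature.NumberTheory.EllipticCurves.Monsky1990.cor515_rank_eq_one_and_card_selmerGroup_two ∧ Literature.NumberTheory.EllipticCurves.HeathBrown1994.monsky_card_selmerGroup_two_even ∧ Literature.NumberTheory.EllipticCurves.Tian2014.tian2014_system_sMinus_genus)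 → Summit.BirchSwinnertonDyer.WAllCornerFTwoRamifiedOffBookedIsogenyOffThetaFour) :
    (Literature.NumberTheory.EllipticCurves.rank_eq_analyticRank_of_analyticRank_le_one ∧ WeierstrassCurve.hasEntireLFunction_rat ∧ WeierstrassCurve.bsdRHS_eq_of_isIsogenous ∧ Literature.NumberTheory.EllipticCurves.bsdTriple_of_hasCM_of_L_one_ne_zero ∧ Literature.NumberTheory.EllipticCurves.TianYuanZhang2017.thm12_parity_of_scriptL' ∧ Literature.NumberTheory.EllipticCurves.Tian2014.thm13_rank_one_and_sha_odd ∧ Literature.NumberTheory.QuadraticFields.RedeiReichardt.redeiReichardt_fourTwoCard_classGroup ∧ Literature.NumberTheory.EllipticCurves.LiLiuTian2024.thm12_bsd_congruentNumberCurve ∧ Literature.NumberTheory.EllipticCurves.Monsky1990.cor515_rank_eq_one_and_card_selmerGroup_two ∧ Literature.NumberTheory.EllipticCurves.HeathBrown1994.monsky_card_selmerGroup_two_even ∧ Literature.NumberTheory.EllipticCurves.Tian2014.tian2014_system_sMinus_genus) → Summit.BirchSwinnertonDyer.WAllCornerFTwoRamifiedOffBookedIsogeny :=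
  fun hB ↦ wAllCornerFTwoRamifiedOffBookedIsogeny_of_thetaFour_of_off (hT hB) (hO hB)

/-- **Crux 20509's conclusion from the bundle, the four beyond-bundle leaves and the residual off them** — the
composition `RamifiedOffTYZOfFacts_of` of the lead's skeleton: U⁺ leaf (`hU`, aside 20471), theta leaf (`hT`, aside
21185), Shu–Zhai `256c1` leaf (`hZ`, aside 21183), four-prime theta leaf (`hT4`, aside TURNKEY), residual (`hO`, OPEN).
[folklore] -/
theorem offTYZProved_of_bundle_of_uPlus_of_theta_of_shuZhai_of_thetaFour_of_off
    (hB : (Literature.NumberTheory.EllipticCurves.rank_eq_analyticRank_of_analyticRank_le_one ∧ WeierstrassCurve.hasEntireLFunction_rat ∧ WeierstrassCurve.bsdRHS_eq_of_isIsogenous ∧ Literature.NumberTheory.EllipticCurves.bsdTriple_of_hasCM_of_L_one_ne_zero ∧ Literature.NumberTheory.EllipticCurves.TianYuanZhang2017.thm12_parity_of_scriptL' ∧ Literature.NumberTheory.EllipticCurves.Tian2014.thm13_rank_one_and_sha_odd ∧ Literature.NumberTheory.QuadraticFields.RedeiReichardt.redeiReichardt_fourTwoCard_classGroup ∧ Literature.NumberTheory.EllipticCurves.LiLiuTian2024.thm12_bsd_congruentNumberCurve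 ∧ Literature.NumberTheory.EllipticCurves.Monsky1990.cor515_rank_eq_one_and_card_selmerGroup_two ∧ Literature.NumberTheory.EllipticCurves.HeathBrown1994.monsky_card_selmerGroup_two_even ∧ Literature.NumberTheory.EllipticCurves.Tian2014.tian2014_system_sMinus_genus))
    (hU : WAllCornerFTwoRamifiedTYZUPlus) (hT : WAllCornerFTwoRamifiedTheta)
    (hZ : WAllCornerFTwoRamifiedShuZhaiTwoFiftySix) (hT4 : WAllCornerFTwoRamifiedThetaFour)
    (hO : WAllCornerFTwoRamifiedOffBookedIsogenyOffThetaFour) : WAllCornerFTwoRamifiedOffTYZProved :=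
  offTYZProved_of_bundle_of_uPlus_of_theta_of_shuZhai_of_off hB hU hT hZ
    (wAllCornerFTwoRamifiedOffBookedIsogeny_of_thetaFour_of_off hT4 hO)

end Summit.BirchSwinnertonDyer.PrintCf2

end
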